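import Mathlib
import HarnessLib
import Literature.Probability.MarkovChains.TotalVariation

/-!
# The two-state chain: `π = (q, p)/(p+q)`, `Δ_{t+1} = (1−p−q)Δ_t`, eigenvalue `1 − p − q`, exact total-variation decay (Levin–Peres–Wilmer Example 1.1, Remark 1.2)

HONEST FRAMING: exact (Metropolis-corrected) sampling algorithms for lattice gauge theory; figures
of merit are autocorrelation/cost numbers at stated couplings and volumes; no continuum-physics claim.

Conventions of `TotalVariation.lean` / `MetropolisHastings.lean`: ROW kernel `P : X → X → ℝ`,
`stepLaw P μ = μP`, `lawAt P μ t = μPᵗ`, `tvDist`, `IsRowStochastic`, `IsStationary`,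
`DetailedBalance`.  Source: D. A. Levin, Y. Peres (with E. L. Wilmer), *Markov Chains and Mixing
Times*, 2nd ed., AMS 2017 [LevinPeres2017], §1.1 Example 1.1 (the frog on two lily pads),
eqs. (1.2)–(1.9), and Remark 1.2, pp. 3–4.  Everything is PROVED (0 named facts).  States:
`0 = e` (east), `1 = w` (west) in `Fin 2`.

* `twoStateKernel p q` — **eq. (1.2)** `P = [[1−p, p], [q, 1−q]]` [cite: LevinPeres2017, §1.1
  Example 1.1, eq. (1.2)]; `twoStateKernel_isRowStochastic` (`0 ≤ p, q ≤ 1`);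
* `twoStateLaw p q` — `π(e) = q/(p+q)`, `π(w) = p/(p+q)` [cite: LevinPeres2017, §1.1 Example 1.1
  (display after (1.7))]; `twoStateLaw_detailedBalance`, `twoStateLaw_isStationary` (`p + q ≠ 0`),
  `sum_twoStateLaw`;
* **EQ. (1.8)** `LevinPeres2017_eq_1_8` — `Δ_{t+1} = (1 − p − q)Δ_t` for `Δ_t = μ_t(e) − q/(p+q)`
  and any initial probability vector `μ_0`; **REMARK 1.2** `LevinPeres2017_remark_1_2` —
  `Δ_t = (1−p−q)ᵗ Δ_0`, and `twoStateKernel_mulVec_eigen` — `1 − p − q` is an eigenvalue of `P`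
  (right eigenvector `(p, −q)ᵀ`) [cite: LevinPeres2017, §1.1 eq. (1.8), Remark 1.2];
* **EQ. (1.9)** `LevinPeres2017_eq_1_9` — for `0 < p < 1`, `0 < q < 1`: `μ_t(e) → q/(p+q)` and
  `μ_t(w) → p/(p+q)` for any initial distribution [cite: LevinPeres2017, §1.1 eq. (1.9)];
* `tvDist_lawAt_twoState` — the exact profile `‖μ_t − π‖_TV = |1−p−q|ᵗ·|μ_0(e) − π(e)|`
  [cite: LevinPeres2017, §1.1 Remark 1.2 ("this eigenvalue determines the rate of convergence in
  (1.9)") with §4.1 Prop. 4.2].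

Context (cell pub-lqcd, venture LatticeQCDFlow): the two-state chain is the exactly solvable model
of a single accept/reject bit; `1 − p − q` is its one nontrivial autocorrelation mode, and the
closed form above is the calibration point for integrated-autocorrelation estimators.
-/

namespace Literature.Probability.MarkovChains

open Finset Matrix Filter Topology

/-- **Eq. (1.2)**: the frog's transition matrix `P(e,e) = 1−p`, `P(e,w) = p`, `P(w,e) = q`,
`P(w,w) = 1−q` (`0 = e`, `1 = w`). [cite: LevinPeres2017, §1.1 Example 1.1, eq. (1.2)] -/
def twoStateKernel (p q : ℝ) : Fin 2 → Fin 2 → ℝ :=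
  fun x y => ![![1 - p, p], ![q, 1 - q]] x y

/-- The stationary distribution `π(e) = q/(p+q)`, `π(w) = p/(p+q)`. [cite: LevinPeres2017, §1.1
Example 1.1 (the display after eq. (1.7))] -/
noncomputable def twoStateLaw (p q : ℝ) : Fin 2 → ℝ := ![q / (p + q), p / (p + q)]

/-- `P(e,e) = 1 − p`. [cite: LevinPeres2017, §1.1 eq. (1.2)] -/
@[simp] theorem twoStateKernel_zero_zero (p q : ℝ) : twoStateKernel p q 0 0 = 1 - p := rfl

/-- `P(e,w) = p`. [cite: LevinPeres2017, §1.1 eq. (1.2)] -/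
@[simp] theorem twoStateKernel_zero_one (p q : ℝ) : twoStateKernel p q 0 1 = p := rfl

/-- `P(w,e) = q`. [cite: LevinPeres2017, §1.1 eq. (1.2)] -/
@[simp] theorem twoStateKernel_one_zero (p q : ℝ) : twoStateKernel p q 1 0 = q := rfl

/-- `P(w,w) = 1 − q`. [cite: LevinPeres2017, §1.1 eq. (1.2)] -/
@[simp] theorem twoStateKernel_one_one (p q : ℝ) : twoStateKernel p q 1 1 = 1 - q := rfl

/-- `π(e) = q/(p+q)`. [cite: LevinPeres2017, §1.1 Example 1.1] -/
@[simp] theorem twoStateLaw_zero (p q : ℝ) : twoStateLaw p q 0 = q / (p + q) := rfl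

/-- `π(w) = p/(p+q)`. [cite: LevinPeres2017, §1.1 Example 1.1] -/
@[simp] theorem twoStateLaw_one (p q : ℝ) : twoStateLaw p q 1 = p / (p + q) := rfl

/-- `P` is a transition matrix for `0 ≤ p ≤ 1`, `0 ≤ q ≤ 1`. [cite: LevinPeres2017, §1.1
Example 1.1] -/
theorem twoStateKernel_isRowStochastic {p q : ℝ} (hp0 : 0 ≤ p) (hp1 : p ≤ 1) (hq0 : 0 ≤ q)
    (hq1 : q ≤ 1) : IsRowStochastic (twoStateKernel p q) := by
  refine ⟨fun x y => ?_, fun x => ?_⟩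
  · fin_cases x <;> fin_cases y <;> simp <;> linarith
  · fin_cases x <;> simp [Fin.sum_univ_two]

/-- The rows of `P` sum to `1` (for all `p, q`). [cite: LevinPeres2017, §1.1 Example 1.1,
eq. (1.2)] -/
theorem sum_twoStateKernel (p q : ℝ) (x : Fin 2) : ∑ y, twoStateKernel p q x y = 1 := by
  fin_cases x <;> simp [Fin.sum_univ_two]

/-- `π(e) + π(w) = 1` (`p + q ≠ 0`). [cite: LevinPeres2017, §1.1 Example 1.1] -/
theorem sum_twoStateLaw {p q : ℝ} (hpq : p + q ≠ 0) : ∑ x, twoStateLaw p q x = 1 := by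
  rw [Fin.sum_univ_two, twoStateLaw_zero, twoStateLaw_one, ← add_div, add_comm, div_self hpq]

/-- Every two-state chain is reversible with respect to `π`: `π(e)P(e,w) = qp/(p+q) = π(w)P(w,e)`.
[cite: LevinPeres2017, §1.1 Example 1.1 with §1.6 eq. (1.29)] -/
theorem twoStateLaw_detailedBalance (p q : ℝ) :
    DetailedBalance (twoStateLaw p q) (twoStateKernel p q) := by
  intro x y
  fin_cases x <;> fin_cases y <;> simp <;> ring

/-- **`π = πP`**: `π` is stationary (`p + q ≠ 0`; "any such limit distribution `π` must satisfy
`π = πP`, which implies … `π(e) = q/(p+q)`, `π(w) = p/(p+q)`"). [cite: LevinPeres2017, §1.1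
Example 1.1 (the display after eq. (1.7))] -/
theorem twoStateLaw_isStationary (p q : ℝ) : IsStationary (twoStateLaw p q) (twoStateKernel p q) :=
  (twoStateLaw_detailedBalance p q).isStationary (sum_twoStateKernel p q)

/-- One step of the law at `e`: `μ_{t+1}(e) = μ_t(e)(1−p) + μ_t(w)q`. [cite: LevinPeres2017, §1.1
eqs. (1.4), (1.6)] -/
theorem stepLaw_twoState_zero (p q : ℝ) (μ : Fin 2 → ℝ) :
    stepLaw (twoStateKernel p q) μ 0 = μ 0 * (1 - p) + μ 1 * q := by
  simp [stepLaw, Fin.sum_univ_two]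

/-- One step of the law at `w`: `μ_{t+1}(w) = μ_t(e)p + μ_t(w)(1−q)`. [cite: LevinPeres2017, §1.1
eqs. (1.5), (1.6)] -/
theorem stepLaw_twoState_one (p q : ℝ) (μ : Fin 2 → ℝ) :
    stepLaw (twoStateKernel p q) μ 1 = μ 0 * p + μ 1 * (1 - q) := by
  simp [stepLaw, Fin.sum_univ_two]

/-- Mass is conserved: `μ_t(e) + μ_t(w) = μ_0(e) + μ_0(w)`. [cite: LevinPeres2017, §1.1 eq. (1.7)
(`μ_t = μ_0Pᵗ` is a distribution)] -/
theorem lawAt_twoState_sum (p q : ℝ) (μ : Fin 2 → ℝ) (t : ℕ) :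
    lawAt (twoStateKernel p q) μ t 0 + lawAt (twoStateKernel p q) μ t 1 = μ 0 + μ 1 := by
  induction t with
  | zero => simp [lawAt_zero]
  | succ t ih =>
    rw [lawAt_succ, stepLaw_twoState_zero, stepLaw_twoState_one, ← ih]
    ring

/-- **EQ. (1.8): `Δ_{t+1} = μ_t(e)(1−p) + (1 − μ_t(e))q − q/(p+q) = (1 − p − q)Δ_t`** for
`Δ_t = μ_t(e) − q/(p+q)` and an initial probability vector `μ_0` (`p + q ≠ 0`).
[cite: LevinPeres2017, §1.1 eq. (1.8)] -/
theorem LevinPeres2017_eq_1_8 {p q : ℝ} (hpq : p + q ≠ 0) {μ : Fin 2 → ℝ} (hμ : μ 0 + μ 1 = 1)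
    (t : ℕ) :
    lawAt (twoStateKernel p q) μ (t + 1) 0 - q / (p + q) =
      (1 - p - q) * (lawAt (twoStateKernel p q) μ t 0 - q / (p + q)) := by
  have hmass := lawAt_twoState_sum p q μ t
  rw [hμ] at hmass
  rw [lawAt_succ, stepLaw_twoState_zero, show lawAt (twoStateKernel p q) μ t 1 =
    1 - lawAt (twoStateKernel p q) μ t 0 by linarith]
  field_simp
  ring

/-- **REMARK 1.2: `Δ_t = (1 − p − q)ᵗ Δ_0`.** [cite: LevinPeres2017, §1.1 Remark 1.2] -/
theorem LevinPeres2017_remark_1_2 {p q : ℝ} (hpq : p + q ≠ 0) {μ : Fin 2 → ℝ}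
    (hμ : μ 0 + μ 1 = 1) (t : ℕ) :
    lawAt (twoStateKernel p q) μ t 0 - q / (p + q) = (1 - p - q) ^ t * (μ 0 - q / (p + q)) := by
  induction t with
  | zero => simp [lawAt_zero]
  | succ t ih => rw [LevinPeres2017_eq_1_8 hpq hμ, ih, pow_succ]; ring

/-- **REMARK 1.2: "`1 − p − q` is an eigenvalue of the frog's transition matrix `P`"** — with right
eigenvector `(p, −q)ᵀ`. [cite: LevinPeres2017, §1.1 Remark 1.2] -/
theorem twoStateKernel_mulVec_eigen (p q : ℝ) :
    (Matrix.of (twoStateKernel p q)) *ᵥ ![p, -q] = (1 - p - q) • ![p, -q] := by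
  funext x
  fin_cases x <;> simp [mulVec, dotProduct, Fin.sum_univ_two] <;> ring

/-- The law at `w`: `μ_t(w) − p/(p+q) = −Δ_t`. [cite: LevinPeres2017, §1.1 eq. (1.9) (the second
limit)] -/
theorem lawAt_twoState_one_sub {p q : ℝ} (hpq : p + q ≠ 0) {μ : Fin 2 → ℝ} (hμ : μ 0 + μ 1 = 1)
    (t : ℕ) :
    lawAt (twoStateKernel p q) μ t 1 - p / (p + q) =
      -(lawAt (twoStateKernel p q) μ t 0 - q / (p + q)) := by
  have hmass := lawAt_twoState_sum p q μ t
  rw [hμ] at hmass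
  have h1 : q / (p + q) + p / (p + q) = 1 := by rw [← add_div, add_comm, div_self hpq]
  linarith

/-- **EQ. (1.9): when `0 < p < 1` and `0 < q < 1`, `μ_t(e) → q/(p+q)` and `μ_t(w) → p/(p+q)` for
any initial distribution `μ_0`** (`|1 − p − q| < 1`). [cite: LevinPeres2017, §1.1 eq. (1.9)] -/
theorem LevinPeres2017_eq_1_9 {p q : ℝ} (hp0 : 0 < p) (hp1 : p < 1) (hq0 : 0 < q) (hq1 : q < 1)
    {μ : Fin 2 → ℝ} (hμ : μ 0 + μ 1 = 1) :
    Tendsto (fun t => lawAt (twoStateKernel p q) μ t 0) atTop (𝓝 (q / (p + q))) ∧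
      Tendsto (fun t => lawAt (twoStateKernel p q) μ t 1) atTop (𝓝 (p / (p + q))) := by
  have hpq : p + q ≠ 0 := by linarith
  have habs : |1 - p - q| < 1 := by rw [abs_lt]; constructor <;> linarith
  have hpow : Tendsto (fun t : ℕ => (1 - p - q) ^ t * (μ 0 - q / (p + q))) atTop (𝓝 0) := by
    have h := (tendsto_pow_atTop_nhds_zero_of_abs_lt_one habs).mul_const (μ 0 - q / (p + q))
    rwa [zero_mul] at h
  have h0 : Tendsto (fun t => lawAt (twoStateKernel p q) μ t 0) atTop (𝓝 (q / (p + q))) := by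
    have h := hpow.add_const (q / (p + q))
    rw [zero_add] at h
    refine h.congr fun t => ?_
    have := LevinPeres2017_remark_1_2 hpq hμ t
    linarith
  refine ⟨h0, ?_⟩
  have h := (h0.const_sub 1)
  have h1 : 1 - q / (p + q) = p / (p + q) := by field_simp; ring
  rw [h1] at h
  refine h.congr fun t => ?_
  have hmass := lawAt_twoState_sum p q μ t
  rw [hμ] at hmass
  linarith

/-- **The exact total-variation profile: `‖μ_t − π‖_TV = |1 − p − q|ᵗ · |μ_0(e) − π(e)|`** for an
initial probability vector `μ_0` (`p + q ≠ 0`): the two deviations are `±Δ_t`.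
[cite: LevinPeres2017, §1.1 Remark 1.2 ("this eigenvalue determines the rate of convergence in
(1.9)") with §4.1 eq. (4.1) / Prop. 4.2 (`‖μ − ν‖_TV = ½ Σ|μ(x) − ν(x)|`)] -/
theorem tvDist_lawAt_twoState {p q : ℝ} (hpq : p + q ≠ 0) {μ : Fin 2 → ℝ} (hμ : μ 0 + μ 1 = 1)
    (t : ℕ) :
    tvDist (lawAt (twoStateKernel p q) μ t) (twoStateLaw p q) =
      |1 - p - q| ^ t * |μ 0 - q / (p + q)| := by
  unfold tvDist
  rw [Fin.sum_univ_two, twoStateLaw_zero, twoStateLaw_one, lawAt_twoState_one_sub hpq hμ, abs_neg,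
    LevinPeres2017_remark_1_2 hpq hμ, abs_mul, abs_pow]
  ring

end Literature.Probability.MarkovChains
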